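import Mathlib
import Summits.MatrixMultiplication.MatrixMultiplication.Theorems.GradedDesignFamily.Negative.SubfieldCellBGT
import Literature.GroupTheory.ApproximateGroups.ProductTheoremSL2

/-!
# `¬S3` from the NAMED literature fact `BreuillardGreenTao2011_SL2` (crux
# `LevelGradedCohnUmans.GradedDesignFamily`, stmt-MatrixMultiplication-7610; negative side,
# line `quadratic-extension-level-one-cell`, unit b2b-lgcu-subfield gen 19)

HONEST FRAMING.  `not_subfieldCell_of_BGT` decides the design stub `stub_subfieldCell` (S3)
NEGATIVELY modulo the inline hypothesis (BGT) — the product theorem for `SL₂` over a finite field,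
spelled for determinant-one finite subsets of `GL₂(K)` with Mathlib's `IsApproximateSubgroup`.
This file derives (BGT) from the tree's NAMED FACT
`Literature.GroupTheory.ApproximateGroups.BreuillardGreenTao2011_SL2`
[cite: BreuillardGreenTao2011, Theorem 2.3] (via its proved corollary `card_dichotomy`), by
transporting an approximate subgroup of `GL₂(K)` made of determinant-one matrices to `SL₂(K)` along
`Matrix.SpecialLinearGroup.toGL`, and restates the capstone with the named fact as its only
hypothesis: `not_subfieldCell_of_BGT2011`.  So S3 is FALSE conditionally on exactly one cited,
unproved-in-tree published theorem.  A NEGATIVE decision of a design stub; NOT summit progress.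

Sorry-free. [folklore]
-/

set_option linter.dupNamespace false

open scoped BigOperators Pointwise MatrixGroups

namespace Summit.MatrixMultiplication.MatrixMultiplication.Theorems.GradedDesignFamily.Negative

open Literature.GroupTheory.ApproximateGroups

/-- **(BGT) from the named fact.**  The inline product-theorem hypothesis (BGT) of
`not_subfieldCell_of_BGT` follows from `BreuillardGreenTao2011_SL2`: a `K₀`-approximate subgroup
`B ⊆ GL₂(K)` of determinant-one matrices generating `ker det` lifts along `toGL` to a
`max K₀ 2`-approximate subgroup of `SL₂(K)` generating `SL₂(K)`, and `|ker det| ≤ |SL₂(K)|`.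
NOT summit progress. [cite: BreuillardGreenTao2011, Theorem 2.3] -/
theorem subfieldCell_BGT_of_BGT2011 (h : BreuillardGreenTao2011_SL2) :
    ∃ C : ℝ → ℝ, ∀ K₀ : ℝ, 1 ≤ C K₀ ∧
      ∀ (K : Type) [Field K] [Fintype K] [DecidableEq K]
        (B : Finset (Matrix.GeneralLinearGroup (Fin 2) K)),
        (∀ b ∈ B, Matrix.GeneralLinearGroup.det b = 1) →
        IsApproximateSubgroup K₀ (B : Set (Matrix.GeneralLinearGroup (Fin 2) K)) →
        Subgroup.closure (B : Set (Matrix.GeneralLinearGroup (Fin 2) K)) =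
          (Matrix.GeneralLinearGroup.det : Matrix.GeneralLinearGroup (Fin 2) K →* Kˣ).ker →
        (B.card : ℝ) ≤ C K₀ ∨
          (Nat.card (Matrix.GeneralLinearGroup.det :
              Matrix.GeneralLinearGroup (Fin 2) K →* Kˣ).ker : ℝ) ≤ C K₀ * B.card := by
  classical
  obtain ⟨C, hC⟩ := BreuillardGreenTao2011_SL2.card_dichotomy h
  refine ⟨fun K₀ => (max K₀ 2) ^ C, fun K₀ => ⟨?_, ?_⟩⟩
  · exact one_le_pow₀ ((show (1 : ℝ) ≤ 2 by norm_num).trans (le_max_right _ _))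
  intro K _ _ _ B hdet happ hgen
  -- ### the lift `A ⊆ SL₂(K)` of `B` along `toGL`
  have hinj : Function.Injective (Matrix.SpecialLinearGroup.toGL :
      Matrix.SpecialLinearGroup (Fin 2) K → Matrix.GeneralLinearGroup (Fin 2) K) := by
    intro a b hab
    refine Matrix.SpecialLinearGroup.ext _ _ fun i j => ?_
    have := congr_arg (fun g : Matrix.GeneralLinearGroup (Fin 2) K =>
      (g : Matrix (Fin 2) (Fin 2) K) i j) hab
    simpa [Matrix.SpecialLinearGroup.coe_GL_coe_matrix] using this
  set A : Finset (Matrix.SpecialLinearGroup (Fin 2) K) :=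
    Finset.univ.filter (fun a : Matrix.SpecialLinearGroup (Fin 2) K =>
      Matrix.SpecialLinearGroup.toGL a ∈ B) with hAdef
  have hAmem : ∀ a, a ∈ A ↔ Matrix.SpecialLinearGroup.toGL a ∈ B := by
    intro a
    simp [hAdef]
  -- every determinant-one element of `GL₂(K)` lifts
  have hliftGL : ∀ x : Matrix.GeneralLinearGroup (Fin 2) K, Matrix.GeneralLinearGroup.det x = 1 →
      ∃ a : Matrix.SpecialLinearGroup (Fin 2) K, Matrix.SpecialLinearGroup.toGL a = x := by
    intro x hx
    have hx1 : Matrix.det (x : Matrix (Fin 2) (Fin 2) K) = 1 := by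
      rw [← Matrix.GeneralLinearGroup.val_det_apply, hx, Units.val_one]
    exact ⟨⟨(x : Matrix (Fin 2) (Fin 2) K), hx1⟩,
      Units.ext (by rw [Matrix.SpecialLinearGroup.coe_GL_coe_matrix])⟩
  have hlift : ∀ b ∈ B, ∃ a ∈ A, Matrix.SpecialLinearGroup.toGL a = b := by
    intro b hb
    obtain ⟨a, rfl⟩ := hliftGL b (hdet b hb)
    exact ⟨a, (hAmem a).2 hb, rfl⟩
  have hAimg : A.image Matrix.SpecialLinearGroup.toGL = B := by
    ext b
    constructor
    · intro hb
      obtain ⟨a, ha, rfl⟩ := Finset.mem_image.1 hb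
      exact (hAmem a).1 ha
    · intro hb
      obtain ⟨a, ha, rfl⟩ := hlift b hb
      exact Finset.mem_image.2 ⟨a, ha, rfl⟩
  have hcard : A.card = B.card := by
    rw [← hAimg, Finset.card_image_of_injective _ hinj]
  -- ### `A` is a `max K₀ 2`-approximate subgroup of `SL₂(K)`
  have hsymmB : ∀ x : Matrix.GeneralLinearGroup (Fin 2) K, x⁻¹ ∈ B ↔ x ∈ B := by
    intro x
    rw [← Finset.mem_coe, ← Set.mem_inv, happ.inv_eq_self, Finset.mem_coe]
  have happA : IsApproximateSubgroup (max K₀ 2)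
      (A : Set (Matrix.SpecialLinearGroup (Fin 2) K)) := by
    refine IsApproximateSubgroup.mono (le_max_left _ _) ⟨?_, ?_, ?_⟩
    · rw [Finset.mem_coe, hAmem, map_one]
      exact Finset.mem_coe.1 happ.one_mem
    · ext a
      rw [Set.mem_inv, Finset.mem_coe, Finset.mem_coe, hAmem, hAmem, map_inv]
      exact hsymmB _
    · obtain ⟨X, hXK, hX⟩ := happ.sq_covBySMul
      set X' : Finset (Matrix.SpecialLinearGroup (Fin 2) K) :=
        Finset.univ.filter (fun x : Matrix.SpecialLinearGroup (Fin 2) K =>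
          Matrix.SpecialLinearGroup.toGL x ∈ X) with hX'def
      have hX'mem : ∀ x, x ∈ X' ↔ Matrix.SpecialLinearGroup.toGL x ∈ X := by
        intro x
        simp [hX'def]
      refine ⟨X', ?_, ?_⟩
      · have h1 : X'.card ≤ X.card := by
          calc X'.card = (X'.image Matrix.SpecialLinearGroup.toGL).card :=
                (Finset.card_image_of_injective _ hinj).symm
            _ ≤ X.card := Finset.card_le_card (by
                intro x hx
                obtain ⟨x', hx', rfl⟩ := Finset.mem_image.1 hx
                exact (hX'mem x').1 hx')
        exact le_trans (by exact_mod_cast h1) hXK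
      · intro g hg
        rw [sq, Set.mem_mul] at hg
        obtain ⟨a₁, ha₁, a₂, ha₂, rfl⟩ := hg
        have h12 : Matrix.SpecialLinearGroup.toGL a₁ * Matrix.SpecialLinearGroup.toGL a₂ ∈
            (B : Set (Matrix.GeneralLinearGroup (Fin 2) K)) ^ 2 := by
          rw [sq]
          exact Set.mul_mem_mul ((hAmem _).1 ha₁) ((hAmem _).1 ha₂)
        obtain ⟨x, hx, b, hb, hxb⟩ := Set.mem_smul.1 (hX h12)
        rw [smul_eq_mul] at hxb
        have hbB : b ∈ B := Finset.mem_coe.1 hb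
        have hxdet : Matrix.GeneralLinearGroup.det x = 1 := by
          have e : x = Matrix.SpecialLinearGroup.toGL a₁ * Matrix.SpecialLinearGroup.toGL a₂ *
              b⁻¹ := by
            rw [← hxb, mul_inv_cancel_right]
          rw [e, map_mul, map_inv, hdet b hbB, inv_one, mul_one, ← map_mul]
          exact Units.ext (by
            rw [Matrix.GeneralLinearGroup.val_det_apply, Units.val_one,
              Matrix.SpecialLinearGroup.coe_GL_coe_matrix]
            exact Matrix.SpecialLinearGroup.det_coe _)
        obtain ⟨x', hx'⟩ := hliftGL x hxdet
        obtain ⟨b', hb'A, hb'⟩ := hlift b hbB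
        refine Set.mem_smul.2 ⟨x', ?_, b', Finset.mem_coe.2 hb'A, ?_⟩
        · rw [Finset.mem_coe, hX'mem, hx']
          exact Finset.mem_coe.1 hx
        · rw [smul_eq_mul]
          apply hinj
          rw [map_mul, map_mul, hx', hb', hxb]
  -- ### `A` generates `SL₂(K)`
  have hgenA : Subgroup.closure (A : Set (Matrix.SpecialLinearGroup (Fin 2) K)) = ⊤ := by
    rw [eq_top_iff]
    intro g _
    have hg : Matrix.SpecialLinearGroup.toGL g ∈
        (Matrix.GeneralLinearGroup.det : Matrix.GeneralLinearGroup (Fin 2) K →* Kˣ).ker := by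
      rw [MonoidHom.mem_ker]
      exact Units.ext (by
        rw [Matrix.GeneralLinearGroup.val_det_apply, Units.val_one,
          Matrix.SpecialLinearGroup.coe_GL_coe_matrix]
        exact Matrix.SpecialLinearGroup.det_coe _)
    have hBimg : (B : Set (Matrix.GeneralLinearGroup (Fin 2) K)) =
        Matrix.SpecialLinearGroup.toGL '' (A : Set (Matrix.SpecialLinearGroup (Fin 2) K)) := by
      rw [← Finset.coe_image, hAimg]
    rw [← hgen, hBimg, ← MonoidHom.map_closure] at hg
    obtain ⟨g', hg', hgg'⟩ := Subgroup.mem_map.1 hg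
    rw [← hinj hgg']
    exact hg'
  -- ### `|ker det| ≤ |SL₂(K)|`
  have hker : Nat.card (Matrix.GeneralLinearGroup.det :
      Matrix.GeneralLinearGroup (Fin 2) K →* Kˣ).ker ≤
      Fintype.card (Matrix.SpecialLinearGroup (Fin 2) K) := by
    rw [← Nat.card_eq_fintype_card]
    refine Nat.card_le_card_of_injective
      (fun g => (⟨((g : Matrix.GeneralLinearGroup (Fin 2) K) : Matrix (Fin 2) (Fin 2) K), ?_⟩ :
        Matrix.SpecialLinearGroup (Fin 2) K)) ?_
    · rw [← Matrix.GeneralLinearGroup.val_det_apply, MonoidHom.mem_ker.1 g.2, Units.val_one]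
    · intro g g' e
      exact Subtype.ext (Units.ext (congr_arg
        (fun s : Matrix.SpecialLinearGroup (Fin 2) K => (s : Matrix (Fin 2) (Fin 2) K)) e))
  -- ### conclude
  rcases hC K (max K₀ 2) (le_max_right _ _) A happA hgenA with h1 | h1
  · left
    rw [← hcard]
    exact h1
  · right
    calc (Nat.card (Matrix.GeneralLinearGroup.det :
            Matrix.GeneralLinearGroup (Fin 2) K →* Kˣ).ker : ℝ)
          ≤ Fintype.card (Matrix.SpecialLinearGroup (Fin 2) K) := by exact_mod_cast hker
      _ ≤ (max K₀ 2) ^ C * A.card := h1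
      _ = (max K₀ 2) ^ C * B.card := by rw [hcard]

/-- **CAPSTONE modulo the named fact: `BreuillardGreenTao2011_SL2 → ¬S3`.**  The design stub
`stub_subfieldCell` (S3, verbatim) is FALSE conditionally on exactly one cited published theorem,
the Breuillard–Green–Tao product theorem for `SL₂` over finite fields, present in the tree as the
NAMED FACT `Literature.GroupTheory.ApproximateGroups.BreuillardGreenTao2011_SL2` (not proved in the
tree).  Everything else — small-product-set structure (T), determinant pigeonhole, sliced counting,
bounded index, normal form, overgroups, non-generation, sliced endgame, footprint — is proved in
the tree.  A NEGATIVE decision of a design stub; NOT summit progress.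
[cite: BreuillardGreenTao2011, Theorem 2.3] -/
theorem not_subfieldCell_of_BGT2011 (h : BreuillardGreenTao2011_SL2) :
    ¬ (∃ c : ℝ, 0 < c ∧ ∀ N : ℕ, ∃ (k K : Type) (_ : Field k) (_ : Fintype k) (_ : DecidableEq k)
      (_ : Field K) (_ : Fintype K) (_ : DecidableEq K)
      (φ : Matrix.SpecialLinearGroup (Fin 2) k →* Matrix.GeneralLinearGroup (Fin 2) K),
      Function.Injective φ ∧ Fintype.card K = Fintype.card k ^ 2 ∧ N ≤ Fintype.card K ∧
      ∃ Y Z : Finset (Matrix.GeneralLinearGroup (Fin 2) K),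
        c * (Fintype.card K : ℝ) ^ (3 / 2 : ℝ) ≤ (Finset.univ.image φ).card ∧
        c * (Fintype.card K : ℝ) ^ (3 / 2 : ℝ) ≤ Y.card ∧
        c * (Fintype.card K : ℝ) ^ (3 / 2 : ℝ) ≤ Z.card ∧
        ∀ z₀ ∈ Z, ∃ cf : (Fin 2 → K) → (Fin 2 → K) → ℂ,
          ∀ a : Matrix.SpecialLinearGroup (Fin 2) k, ∀ y ∈ Y, ∀ y' ∈ Y, ∀ z ∈ Z,
            (∑ u : Fin 2 → K, cf u (((φ a * y * y'⁻¹ * z : Matrix.GeneralLinearGroup (Fin 2) K) :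
                Matrix (Fin 2) (Fin 2) K).mulVec u)) =
              if a = 1 ∧ y = y' ∧ z = z₀ then 1 else 0) :=
  not_subfieldCell_of_BGT (subfieldCell_BGT_of_BGT2011 h)

end Summit.MatrixMultiplication.MatrixMultiplication.Theorems.GradedDesignFamily.Negative
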